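import Mathlib
import Literature.Combinatorics.Expanders.BoundedConcentrator
import Literature.Combinatorics.Expanders.Concentrator
import HarnessLib

/-!
# The slot model: counting the bad permutations (union-bound inputs)

Counting half of the existence proof of bounded-degree edge expanders (Pinsker 1973 /
Bollobás 1988 type statement; [Chung1997] §6.1; model = the permutation model of
[BurgisserClausenShokrollahi1997] Lemma (13.32) with inputs = outputs, cf. `SlotGraphCuts.lean`).
For a permutation `π` of the slots `Fin N × Fin d` and a vertex set `U` with `|U| = k`:
* `card_bad_mul_choose_le` — the permutations mapping SOME `a`-set of slots of `U` into the
  slots of `U` are `≤ C(kd, a)² (Nd)! / C(Nd, a)` (union bound + `card_perm_mapsTo_mul_choose`);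
* `choose_div_eight_le` — `C(n, ⌊n/8⌋) ≤ 32^{⌊n/8⌋}` (`n ≥ 24`), elementary;
* `card_bad_mul_two_pow_le` — with `a = kd - ⌊kd/8⌋` and `2k ≤ N`: at most `(Nd)!/2^{2⌊kd/8⌋}`
  such permutations (`C(kd,a)(k/N)^a ≤ 32^s 2^{-7s}`, via `choose_mul_pow_le_choose_mul_pow`);
* `card_sameOwner_mul_choose_le`, `four_mul_card_manyMulti_le` — MARKOV for multi-edges: the
  triples `(x, c, c')`, `c ≠ c'`, with both slots sent into the slots of one vertex have total
  number `≤ N d² · N C(d,2) (Nd)!/C(Nd,2) ≤ 2 d² (Nd)!` over all `π`, so at most a quarter of the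
  permutations have `≥ 8 d²` of them.
All constants are crude (no entropy or Stirling estimates are used).

## References
* [Chung1997] §6.1 (PDF pp. 71–72) — held. [BurgisserClausenShokrollahi1997] Lemma (13.32) — held.
-/

namespace Literature.Combinatorics.Expanders

open Finset

/-! ### Counting the bad permutations for one vertex set -/

section Count

variable {N d : ℕ}

/-- Union bound over the `a`-subsets `S` of the slots of `U`: the permutations mapping SOME such
`S` into the slots of `U` number at most `C(|U|d, a) · #{π | π(S₀) ⊆ slots(U)}`, and
`#{π | π(S₀) ⊆ B} · C(Nd, a) = C(|B|, a) · (Nd)!` (`card_perm_mapsTo_mul_choose`). [folklore] -/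
theorem card_bad_mul_choose_le (U : Finset (Fin N)) (a : ℕ) :
    ((univ : Finset (Equiv.Perm (Fin N × Fin d))).filter fun π =>
        ∃ S ∈ powersetCard a (U ×ˢ (univ : Finset (Fin d))),
          ∀ p ∈ S, π p ∈ U ×ˢ (univ : Finset (Fin d))).card * (N * d).choose a ≤
      (U.card * d).choose a * ((U.card * d).choose a * (N * d).factorial) := by
  classical
  set B := U ×ˢ (univ : Finset (Fin d)) with hBdef
  have hB : B.card = U.card * d := by simp [hBdef, card_product]
  have hX : Fintype.card (Fin N × Fin d) = N * d := by simp
  have hsub : ((univ : Finset (Equiv.Perm (Fin N × Fin d))).filter fun π =>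
        ∃ S ∈ powersetCard a B, ∀ p ∈ S, π p ∈ B) ⊆
      (powersetCard a B).biUnion fun S =>
        (univ : Finset (Equiv.Perm (Fin N × Fin d))).filter fun π => ∀ p ∈ S, π p ∈ B := by
    intro π hπ
    obtain ⟨S, hS, h⟩ := (mem_filter.1 hπ).2
    exact mem_biUnion.2 ⟨S, hS, mem_filter.2 ⟨mem_univ _, h⟩⟩
  calc ((univ : Finset (Equiv.Perm (Fin N × Fin d))).filter fun π =>
          ∃ S ∈ powersetCard a B, ∀ p ∈ S, π p ∈ B).card * (N * d).choose a
      ≤ ((powersetCard a B).biUnion fun S =>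
          (univ : Finset (Equiv.Perm (Fin N × Fin d))).filter fun π => ∀ p ∈ S, π p ∈ B).card *
          (N * d).choose a := Nat.mul_le_mul_right _ (card_le_card hsub)
    _ ≤ (∑ S ∈ powersetCard a B, ((univ : Finset (Equiv.Perm (Fin N × Fin d))).filter
          fun π => ∀ p ∈ S, π p ∈ B).card) * (N * d).choose a :=
        Nat.mul_le_mul_right _ card_biUnion_le
    _ = ∑ S ∈ powersetCard a B, ((univ : Finset (Equiv.Perm (Fin N × Fin d))).filter
          fun π => ∀ p ∈ S, π p ∈ B).card * (N * d).choose a := sum_mul _ _ _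
    _ = ∑ S ∈ powersetCard a B, B.card.choose a * (N * d).factorial :=
        sum_congr rfl fun S hS => by
          have hSc : S.card = a := (mem_powersetCard.1 hS).2
          have h := card_perm_mapsTo_mul_choose S B
          rw [hX, hSc] at h
          exact h
    _ = (U.card * d).choose a * ((U.card * d).choose a * (N * d).factorial) := by
        rw [sum_const, card_powersetCard, hB, smul_eq_mul]

/-- `C(n, ⌊n/8⌋) ≤ 32^{⌊n/8⌋}` for `n ≥ 24`, from `C(n,s)·s! ≤ n^s` and `s^s ≤ 3^s·s!`:
`C(n,s)·s^s ≤ (3n)^s ≤ (32 s)^s`. [folklore] -/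
theorem choose_div_eight_le (n : ℕ) (hn : 24 ≤ n) : n.choose (n / 8) ≤ 32 ^ (n / 8) := by
  set s := n / 8 with hs
  have hs3 : 3 ≤ s := by omega
  have hn8 : 3 * n ≤ 32 * s := by omega
  have h1 : s.factorial * n.choose s ≤ n ^ s := by
    rw [← Nat.descFactorial_eq_factorial_mul_choose]
    exact Nat.descFactorial_le_pow n s
  have h2 : s ^ s ≤ 3 ^ s * s.factorial := pow_self_le_three_pow_mul_factorial s
  have h3 : n.choose s * s ^ s ≤ 32 ^ s * s ^ s :=
    calc n.choose s * s ^ s ≤ n.choose s * (3 ^ s * s.factorial) := Nat.mul_le_mul_left _ h2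
      _ = 3 ^ s * (s.factorial * n.choose s) := by ring
      _ ≤ 3 ^ s * n ^ s := Nat.mul_le_mul_left _ h1
      _ = (3 * n) ^ s := by rw [mul_pow]
      _ ≤ (32 * s) ^ s := Nat.pow_le_pow_left hn8 s
      _ = 32 ^ s * s ^ s := by rw [mul_pow]
  exact Nat.le_of_mul_le_mul_right h3 (pow_pos (by omega) s)

/-- **Per-set bound.** For `|U| = k` with `2k ≤ N` and `kd ≥ 24`, put `s = ⌊kd/8⌋`,
`a = kd - s`; the permutations for which some `a`-set of slots of `U` is mapped into the slots
of `U` are at most a `2^{-2s}` fraction of all `(Nd)!`: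
`C(kd,a)² / C(Nd,a) ≤ C(kd, s) (k/N)^a ≤ 32^s 2^{-7s}`. [folklore] -/
theorem card_bad_mul_two_pow_le (U : Finset (Fin N)) (h2 : 2 * U.card ≤ N)
    (h24 : 24 ≤ U.card * d) :
    ((univ : Finset (Equiv.Perm (Fin N × Fin d))).filter fun π =>
        ∃ S ∈ powersetCard (U.card * d - U.card * d / 8) (U ×ˢ (univ : Finset (Fin d))),
          ∀ p ∈ S, π p ∈ U ×ˢ (univ : Finset (Fin d))).card * 2 ^ (2 * (U.card * d / 8)) ≤
      (N * d).factorial := by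
  classical
  set k := U.card with hk
  set n := k * d with hn
  set s := n / 8 with hs
  set a := n - s with ha
  set M := N * d with hM
  set bad := ((univ : Finset (Equiv.Perm (Fin N × Fin d))).filter fun π =>
        ∃ S ∈ powersetCard a (U ×ˢ (univ : Finset (Fin d))),
          ∀ p ∈ S, π p ∈ U ×ˢ (univ : Finset (Fin d))) with hbad
  have hnM : n ≤ M := by
    rw [hn, hM]; exact Nat.mul_le_mul_right _ (by omega)
  have h2nM : 2 * n ≤ M := by
    rw [hn, hM, ← mul_assoc]; exact Nat.mul_le_mul_right _ h2
  have hsn : s ≤ n := Nat.div_le_self _ _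
  have han : a ≤ n := Nat.sub_le _ _
  have haM : a ≤ M := han.trans hnM
  have hnpos : 0 < n := by omega
  -- (i) union bound and (ii) the ratio of binomials
  have h6 : bad.card * M.choose a ≤ n.choose a * (n.choose a * M.factorial) :=
    card_bad_mul_choose_le U a
  have htree : n.choose a * M ^ a ≤ M.choose a * n ^ a := choose_mul_pow_le_choose_mul_pow hnM a
  have hchpos : 0 < M.choose a := Nat.choose_pos haM
  have h7 : bad.card * M ^ a ≤ n.choose a * n ^ a * M.factorial := by
    refine Nat.le_of_mul_le_mul_right ?_ hchpos
    calc bad.card * M ^ a * M.choose a = bad.card * M.choose a * M ^ a := by ring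
      _ ≤ n.choose a * (n.choose a * M.factorial) * M ^ a := Nat.mul_le_mul_right _ h6
      _ = n.choose a * M.factorial * (n.choose a * M ^ a) := by ring
      _ ≤ n.choose a * M.factorial * (M.choose a * n ^ a) := Nat.mul_le_mul_left _ htree
      _ = n.choose a * n ^ a * M.factorial * M.choose a := by ring
  -- (iii) `(2n)^a ≤ M^a`
  have h8 : bad.card * 2 ^ a ≤ n.choose a * M.factorial := by
    refine Nat.le_of_mul_le_mul_right ?_ (pow_pos hnpos a)
    calc bad.card * 2 ^ a * n ^ a = bad.card * (2 * n) ^ a := by rw [mul_pow]; ring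
      _ ≤ bad.card * M ^ a := Nat.mul_le_mul_left _ (Nat.pow_le_pow_left h2nM a)
      _ ≤ n.choose a * n ^ a * M.factorial := h7
      _ = n.choose a * M.factorial * n ^ a := by ring
  -- (iv) `C(n,a) = C(n,s) ≤ 32^s` and (v) `2^a ≥ 2^{7s}`
  have hsymm : n.choose a = n.choose s := by rw [ha, Nat.choose_symm hsn]
  have h32 : n.choose s ≤ 32 ^ s := choose_div_eight_le n (by omega)
  have h7s : 7 * s ≤ a := by omega
  have h9 : bad.card * 2 ^ (7 * s) ≤ 2 ^ (5 * s) * M.factorial :=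
    calc bad.card * 2 ^ (7 * s) ≤ bad.card * 2 ^ a :=
          Nat.mul_le_mul_left _ (Nat.pow_le_pow_right (by norm_num) h7s)
      _ ≤ n.choose a * M.factorial := h8
      _ ≤ 32 ^ s * M.factorial := by rw [hsymm]; exact Nat.mul_le_mul_right _ h32
      _ = 2 ^ (5 * s) * M.factorial := by
          rw [pow_mul]; norm_num
  refine Nat.le_of_mul_le_mul_right ?_ (pow_pos (by norm_num : (0:ℕ) < 2) (5 * s))
  calc bad.card * 2 ^ (2 * s) * 2 ^ (5 * s) = bad.card * 2 ^ (7 * s) := by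
        rw [mul_assoc, ← pow_add]; ring_nf
    _ ≤ 2 ^ (5 * s) * M.factorial := h9
    _ = M.factorial * 2 ^ (5 * s) := by ring

end Count

/-! ### Few multi-edges: Markov's inequality for pairs of slots with the same target owner -/

section Multi

variable {N d : ℕ}

/-- For two distinct slots `p ≠ p'`, the permutations sending both into the slots of one and the
same vertex number at most `N · C(d,2) · (Nd)! / C(Nd,2)`. [folklore] -/
theorem card_sameOwner_mul_choose_le (p p' : Fin N × Fin d) (hpp : p ≠ p') :
    ((univ : Finset (Equiv.Perm (Fin N × Fin d))).filter fun π => (π p).1 = (π p').1).card *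
        (N * d).choose 2 ≤ N * (d.choose 2 * (N * d).factorial) := by
  classical
  have hX : Fintype.card (Fin N × Fin d) = N * d := by simp
  have hsub : ((univ : Finset (Equiv.Perm (Fin N × Fin d))).filter fun π => (π p).1 = (π p').1) ⊆
      (univ : Finset (Fin N)).biUnion fun y =>
        (univ : Finset (Equiv.Perm (Fin N × Fin d))).filter fun π =>
          ∀ q ∈ ({p, p'} : Finset (Fin N × Fin d)), π q ∈ ({y} : Finset (Fin N)) ×ˢ (univ : Finset (Fin d)) := by
    intro π hπ
    have h := (mem_filter.1 hπ).2
    refine mem_biUnion.2 ⟨(π p).1, mem_univ _, mem_filter.2 ⟨mem_univ _, fun q hq => ?_⟩⟩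
    rcases mem_insert.1 hq with rfl | hq
    · exact mem_product.2 ⟨mem_singleton.2 rfl, mem_univ _⟩
    · rw [mem_singleton.1 hq]
      exact mem_product.2 ⟨mem_singleton.2 h.symm, mem_univ _⟩
  have hpair : ({p, p'} : Finset (Fin N × Fin d)).card = 2 := card_pair hpp
  have heach : ∀ y : Fin N,
      ((univ : Finset (Equiv.Perm (Fin N × Fin d))).filter fun π =>
          ∀ q ∈ ({p, p'} : Finset (Fin N × Fin d)),
            π q ∈ ({y} : Finset (Fin N)) ×ˢ (univ : Finset (Fin d))).card * (N * d).choose 2 =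
        d.choose 2 * (N * d).factorial := by
    intro y
    have h := card_perm_mapsTo_mul_choose ({p, p'} : Finset (Fin N × Fin d))
      (({y} : Finset (Fin N)) ×ˢ (univ : Finset (Fin d)))
    rw [hX, hpair, card_product, card_singleton, card_univ, Fintype.card_fin, one_mul] at h
    exact h
  calc ((univ : Finset (Equiv.Perm (Fin N × Fin d))).filter fun π => (π p).1 = (π p').1).card *
        (N * d).choose 2
      ≤ ((univ : Finset (Fin N)).biUnion fun y =>
          (univ : Finset (Equiv.Perm (Fin N × Fin d))).filter fun π =>
            ∀ q ∈ ({p, p'} : Finset (Fin N × Fin d)),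
              π q ∈ ({y} : Finset (Fin N)) ×ˢ (univ : Finset (Fin d))).card * (N * d).choose 2 :=
        Nat.mul_le_mul_right _ (card_le_card hsub)
    _ ≤ (∑ y : Fin N, ((univ : Finset (Equiv.Perm (Fin N × Fin d))).filter fun π =>
            ∀ q ∈ ({p, p'} : Finset (Fin N × Fin d)),
              π q ∈ ({y} : Finset (Fin N)) ×ˢ (univ : Finset (Fin d))).card) * (N * d).choose 2 :=
        Nat.mul_le_mul_right _ card_biUnion_le
    _ = ∑ y : Fin N, d.choose 2 * (N * d).factorial := by
        rw [sum_mul]; exact sum_congr rfl fun y _ => heach y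
    _ = N * (d.choose 2 * (N * d).factorial) := by
        rw [sum_const, card_univ, Fintype.card_fin, smul_eq_mul]

/-- **Markov's inequality for multi-edges.** The number `M(π)` of triples `(x, c, c')`, `c ≠ c'`,
with the two slots `(x,c), (x,c')` sent to slots of the same vertex has
`Σ_π M(π) · C(Nd,2) ≤ N d² · N · C(d,2) · (Nd)!`, hence at most a quarter of all permutations have
`M(π) ≥ 8 d²`. [folklore] -/
theorem four_mul_card_manyMulti_le (hM : 2 ≤ N * d) :
    4 * ((univ : Finset (Equiv.Perm (Fin N × Fin d))).filter fun π =>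
        8 * d ^ 2 ≤ ((univ : Finset (Fin N × Fin d × Fin d)).filter fun t =>
          t.2.1 ≠ t.2.2 ∧ (π (t.1, t.2.1)).1 = (π (t.1, t.2.2)).1).card).card ≤
      (N * d).factorial := by
  classical
  set M := N * d with hMdef
  set T : Equiv.Perm (Fin N × Fin d) → Finset (Fin N × Fin d × Fin d) := fun π =>
    (univ : Finset (Fin N × Fin d × Fin d)).filter fun t =>
      t.2.1 ≠ t.2.2 ∧ (π (t.1, t.2.1)).1 = (π (t.1, t.2.2)).1 with hT
  set Q := (univ : Finset (Equiv.Perm (Fin N × Fin d))).filter fun π => 8 * d ^ 2 ≤ (T π).card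
    with hQ
  -- (A) exchange the order of summation
  have hA : ∑ π : Equiv.Perm (Fin N × Fin d), (T π).card =
      ∑ t : Fin N × Fin d × Fin d, ((univ : Finset (Equiv.Perm (Fin N × Fin d))).filter fun π =>
        t.2.1 ≠ t.2.2 ∧ (π (t.1, t.2.1)).1 = (π (t.1, t.2.2)).1).card := by
    simp only [hT, card_filter]
    exact sum_comm
  -- (B) each triple is counted by few permutations
  have hB : ∀ t : Fin N × Fin d × Fin d,
      ((univ : Finset (Equiv.Perm (Fin N × Fin d))).filter fun π =>
        t.2.1 ≠ t.2.2 ∧ (π (t.1, t.2.1)).1 = (π (t.1, t.2.2)).1).card * M.choose 2 ≤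
        N * (d.choose 2 * M.factorial) := by
    intro t
    by_cases hc : t.2.1 = t.2.2
    · have h0 : ((univ : Finset (Equiv.Perm (Fin N × Fin d))).filter fun π =>
          t.2.1 ≠ t.2.2 ∧ (π (t.1, t.2.1)).1 = (π (t.1, t.2.2)).1) = ∅ := by
        apply filter_eq_empty_iff.2
        intro π _ h
        exact h.1 hc
      rw [h0, card_empty, zero_mul]
      exact Nat.zero_le _
    · have hpp : ((t.1, t.2.1) : Fin N × Fin d) ≠ (t.1, t.2.2) := by
        intro h
        exact hc (Prod.ext_iff.1 h).2
      calc _ ≤ ((univ : Finset (Equiv.Perm (Fin N × Fin d))).filter fun π =>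
              (π (t.1, t.2.1)).1 = (π (t.1, t.2.2)).1).card * M.choose 2 :=
            Nat.mul_le_mul_right _ (card_le_card (fun π hπ =>
              mem_filter.2 ⟨mem_univ _, (mem_filter.1 hπ).2.2⟩))
        _ ≤ N * (d.choose 2 * M.factorial) := card_sameOwner_mul_choose_le _ _ hpp
  -- (C) the total
  have hC : (∑ π : Equiv.Perm (Fin N × Fin d), (T π).card) * M.choose 2 ≤
      (N * (d * d)) * (N * (d.choose 2 * M.factorial)) := by
    rw [hA, sum_mul]
    calc _ ≤ ∑ t : Fin N × Fin d × Fin d, N * (d.choose 2 * M.factorial) := sum_le_sum fun t _ => hB t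
      _ = (N * (d * d)) * (N * (d.choose 2 * M.factorial)) := by
          rw [sum_const, card_univ, smul_eq_mul, Fintype.card_prod, Fintype.card_prod, Fintype.card_fin,
            Fintype.card_fin]
  -- (D) Markov
  have hD : Q.card * (8 * d ^ 2) ≤ ∑ π : Equiv.Perm (Fin N × Fin d), (T π).card :=
    calc Q.card * (8 * d ^ 2) = Q.card • (8 * d ^ 2) := (smul_eq_mul _ _).symm
      _ ≤ ∑ π ∈ Q, (T π).card := card_nsmul_le_sum Q _ _ fun π hπ => (mem_filter.1 hπ).2
      _ ≤ ∑ π : Equiv.Perm (Fin N × Fin d), (T π).card :=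
          sum_le_sum_of_subset_of_nonneg (subset_univ _) fun _ _ _ => Nat.zero_le _
  -- (E) arithmetic: `2 C(M,2) = M (M-1)`, `2 C(d,2) ≤ d²`
  have hdpos : 0 < d := by
    rcases Nat.eq_zero_or_pos d with h | h
    · rw [h, mul_zero] at hMdef; omega
    · exact h
  have hMpos : 0 < M := by omega
  have hM2 : M.choose 2 * 2 = M * (M - 1) := by
    obtain ⟨m, hm⟩ : ∃ m, M = m + 1 := ⟨M - 1, by omega⟩
    have h := Nat.add_one_mul_choose_eq m 1
    rw [Nat.choose_one_right] at h
    rw [hm, Nat.add_sub_cancel]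
    exact h.symm
  have hd2 : d.choose 2 * 2 ≤ d * d := by
    rw [Nat.choose_two_right]
    have := Nat.div_mul_le_self (d * (d - 1)) 2
    exact this.trans (Nat.mul_le_mul_left _ (Nat.sub_le _ _))
  have hE : Q.card * (8 * d ^ 2) * (M * (M - 1)) ≤ M * M * (d * d) * M.factorial := by
    calc Q.card * (8 * d ^ 2) * (M * (M - 1))
        = Q.card * (8 * d ^ 2) * (M.choose 2 * 2) := by rw [hM2]
      _ = Q.card * (8 * d ^ 2) * M.choose 2 * 2 := by ring
      _ ≤ (∑ π : Equiv.Perm (Fin N × Fin d), (T π).card) * M.choose 2 * 2 :=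
          Nat.mul_le_mul_right _ (Nat.mul_le_mul_right _ hD)
      _ ≤ (N * (d * d)) * (N * (d.choose 2 * M.factorial)) * 2 := Nat.mul_le_mul_right _ hC
      _ = (N * d) * (N * d) * M.factorial * (d.choose 2 * 2) := by ring
      _ ≤ (N * d) * (N * d) * M.factorial * (d * d) := Nat.mul_le_mul_left _ hd2
      _ = M * M * (d * d) * M.factorial := by rw [hMdef]; ring
  -- cancel `K = 2 d² M (M-1)` using `M ≤ 2 (M-1)`
  have hMle : M * M ≤ 2 * (M - 1) * M := Nat.mul_le_mul_right M (by omega)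
  have h1 : Q.card * (8 * d ^ 2) * (M * (M - 1)) ≤ 2 * (M - 1) * M * (d * d) * M.factorial :=
    hE.trans (Nat.mul_le_mul_right _ (Nat.mul_le_mul_right _ hMle))
  have hK : 0 < 2 * d ^ 2 * M * (M - 1) :=
    Nat.mul_pos (Nat.mul_pos (Nat.mul_pos (by norm_num) (pow_pos hdpos 2)) hMpos) (by omega)
  refine Nat.le_of_mul_le_mul_right ?_ hK
  calc 4 * Q.card * (2 * d ^ 2 * M * (M - 1)) = Q.card * (8 * d ^ 2) * (M * (M - 1)) := by ring
    _ ≤ 2 * (M - 1) * M * (d * d) * M.factorial := h1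
    _ = M.factorial * (2 * d ^ 2 * M * (M - 1)) := by ring

end Multi

end Literature.Combinatorics.Expanders
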